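import Literature.MathematicalPhysics.QuantumFieldTheory.ConformalBootstrap3D.PointKernelK57Data
import Literature.MathematicalPhysics.QuantumFieldTheory.ConformalBootstrap3D.PointKernelParts

/-!
# K57 certificate, kernel part file P9: one-cell head segments 148, 149 in level ranges

The head cells whose kernel evaluation exceeds one `decide` are one-cell segments of `hsegsK57`; each is
checked by `PCert.hPartSideOK` (side conditions) and `PCert.hPartOK` per level range `[n_lo, n_lo + count)`
against an integer claim, the claims summing to `≥ 0` (`PointKernel.partsOK`); soundness is
`PCert.hParts_sound` (`PointKernelParts`).  The part files `P1, P2, …` are mutually independent (each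
imports only the data file); the ranges of one cell may span several of them, and the per-cell
conclusions `hparts_i` / `hcell_i` of those cells are assembled in `PointKernelK57.lean`.
Estimated kernel time 166 s.
-/

set_option maxRecDepth 100000
set_option maxHeartbeats 0

namespace Literature.MathematicalPhysics.QuantumFieldTheory.ConformalBootstrap3D.PointKernelK57

open Literature.MathematicalPhysics.QuantumFieldTheory.ConformalBootstrap3D.PointKernel

/-- levels `[62, 64)` of segment 148: partial lower sum `≥` claim. [folklore] -/
theorem part_148_11 : certK57.hPartOK (PCert.segAt hsegsK57 148) JHK57 62 2 (43737704675795425764379291813239840) = true := by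
  decide +kernel

/-- levels `[64, 65)` of segment 148: partial lower sum `≥` claim. [folklore] -/
theorem part_148_12 : certK57.hPartOK (PCert.segAt hsegsK57 148) JHK57 64 1 (15470409781728301333693223853924807) = true := by
  decide +kernel

/-- one-cell segment 149 (row 6, cell `[1793/256, 3587/512]`, chord, `n_F = 56`,
7 level ranges): side conditions. [folklore] -/
theorem pside_149 : certK57.hPartSideOK (PCert.segAt hsegsK57 149) JHK57 = true := by
  decide +kernel

/-- its level ranges `(n_lo, count, claim)`. [folklore] -/
def parts_149 : List (ℕ × ℕ × ℤ) := [(0, 24, -14297106325420416228110416939227498284), (24, 10, 9358243029367578777329856302301458032), (34, 7, 2971220545039108442698045160515910856), (41, 6, 1224935284936557667341259433158957217), (47, 5, 520460804951098481159111010317452348), (52, 4, 222405639095743616869690365527335720), (56, 1, -158977969670757287545332593615888)]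

/-- the ranges tile `[0, n_F]` and the claims sum to `≥ 0`. [folklore] -/
theorem pcov_149 : PointKernel.partsOK 56 parts_149 = true := by
  decide +kernel

/-- levels `[0, 24)` of segment 149: partial lower sum `≥` claim. [folklore] -/
theorem part_149_0 : certK57.hPartOK (PCert.segAt hsegsK57 149) JHK57 0 24 (-14297106325420416228110416939227498284) = true := by
  decide +kernel

end Literature.MathematicalPhysics.QuantumFieldTheory.ConformalBootstrap3D.PointKernelK57
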